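import Summits.BirchSwinnertonDyer.BirchSwinnertonDyer.Theorems.ManinLocalTwoThreeKLineQuadSeriesPrelims
import Summits.BirchSwinnertonDyer.BirchSwinnertonDyer.Theorems.ManinLocalTwoThreeKummerTriplingSubring
import Summits.BirchSwinnertonDyer.BirchSwinnertonDyer.Theorems.ManinLocalTwoThreeCubeSystemThreeAdic
import HarnessLib

/-!
# (BI)_K, piece P3: the `3`-adic core — components of the cube root of a `ℚ₃(√r₃)`-rational Kummer series are bounded
(route `ManinLocalTwoThree`, crux C3 `ManinPrimeToThreeAtNine` stmt-BirchSwinnertonDyer-22968 — residual RES₃♭, -an g39's `K`-line, stub (BI)_K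
`UDCKummerLineK.KummerCubeRootThreeBoundedK`; cell bsd-f2-manin, prover seat p2 gen 18; `--supports stmt-BirchSwinnertonDyer-22968`)

Setting (everything `3`-adic): `V/ℤ₃` a short Weierstrass model (`a₁ = a₂ = a₃ = 0`) with elliptic generic fibre, `t ∈ qℤ₃⟦q⟧ ∖ 0` with
`D₃ = [3](t) ≠ 0`, `r₃ = 3^{t₀}·r₀ ∈ ℤ₃` (`r₀` a unit, `t₀ ≤ 1`) NOT a square in `ℚ₃`, and a point `T = (X₁, y·√r₃)` of the generic fibre over
`k = ℚ₃(√r₃)` (`y ∈ ℚ₃ ∖ 0`, `y²r₃ = X₁³ + a₄X₁ + a₆`, `Ψ₃(X₁) = 0`), tangent slope `ℓ·√r₃` (`ℓ·2y r₃ = 3X₁² + a₄`).  The tangent-line Kummer series of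
`T` along `D₃` is `Θ = P + √r₃·Q` with `P = −x̂(D₃)`, `Q = −yD₃³ − ℓ(x̂(D₃)D₃ − X₁D₃³) ∈ ℚ₃⟦q⟧`, `3^{K₀}P, 3^{K₀}Q ∈ ℤ₃⟦q⟧`; let `U + √r₃·V`
(`U, V ∈ ℚ₃⟦q⟧`) be a cube root of `Θ` (component identities).  **Then `3^K U, 3^K V ∈ ℤ₃⟦q⟧` for some `K`** (`components_threeAdicallyBounded`).

Mechanism (p2's revised census, STATUS 2026-08-29T18:4xZ): `k = QuadraticAlgebra ℚ₃ r₃ 0` is a FIELD (Mathlib), `S = ℤ₃ ⊕ ℤ₃ω ≤ k` a subring; p2's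
`kummerTripling_of_subring` (p736306) over `(k, S)` gives `Θ·B³ = A³` with `A, B ∈ S⟦q⟧`; `(hB)³ = A³` forces `hB = ζA` (`eq_C_mul_of_pow_three_eq'`,
`ζ ∈ S` by `norm_le_one_of_pow_three_eq_one`); with `N = B·B̄ ∈ ℤ₃⟦q⟧` and `C′ = ζAB̄ ∈ S⟦q⟧`, `N·h = C′` componentwise and the components satisfy
p3's cube system, so `CubeSystemDescent.dvd_of_cube_system` (p736149) in the UFD `ℤ₃⟦q⟧` bounds `U, V`.

HONEST FRAMING.  The `3`-adic core only; (BI)_K needs the ℚ/ℂ bookkeeping (piece P4); KLINE, RES₃♭, C3, Manin's conjecture and BSD are NOT proved.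
No definitions (the valuation subring `ℤ₃ ⊕ ℤ₃ω` enters as an existence statement), no sorry, no new axioms. [folklore]
-/

set_option autoImplicit false
-- lint-debt: the directory name repeats the summit name (sibling precedent `ManinLocalTwoThreeCubeSystemDescent.lean`)
set_option linter.dupNamespace false

noncomputable section

open scoped Classical QuadraticAlgebra
open PowerSeries WeierstrassCurve Literature.NumberTheory.EllipticCurves

namespace Summit.BirchSwinnertonDyer.BirchSwinnertonDyer.Theorems.ManinLocalTwoThree.KLineBI


/-! ### §1 The subring `ℤ₃ ⊕ ℤ₃ω` of `k = ℚ₃[ω]/(ω² = r₃)` and small facts -/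

/-- The subring `S = {a + bω : ‖a‖, ‖b‖ ≤ 1}` of `QuadraticAlgebra ℚ_[p] r 0` exists as soon as `‖r‖ ≤ 1` (stated as an existence, no definition). [folklore] -/
theorem exists_intSubring {p : ℕ} [Fact p.Prime] (r : ℚ_[p]) (hr : ‖r‖ ≤ 1) :
    ∃ S : Subring (QuadraticAlgebra ℚ_[p] r 0), ∀ z : QuadraticAlgebra ℚ_[p] r 0, z ∈ S ↔ ‖z.re‖ ≤ 1 ∧ ‖z.im‖ ≤ 1 := by
  refine ⟨{ carrier := {z | ‖z.re‖ ≤ 1 ∧ ‖z.im‖ ≤ 1},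
            mul_mem' := ?_,
            one_mem' := by simp,
            add_mem' := ?_,
            zero_mem' := by simp,
            neg_mem' := ?_ }, fun z => Iff.rfl⟩
  · rintro z w ⟨hz1, hz2⟩ ⟨hw1, hw2⟩
    refine ⟨?_, ?_⟩
    · rw [QuadraticAlgebra.re_mul]
      refine (Padic.nonarchimedean _ _).trans (max_le ?_ ?_)
      · rw [norm_mul]; exact mul_le_one₀ hz1 (norm_nonneg _) hw1
      · rw [norm_mul, norm_mul]
        exact mul_le_one₀ (mul_le_one₀ hr (norm_nonneg _) hz2) (norm_nonneg _) hw2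
    · simp only [QuadraticAlgebra.im_mul, zero_mul, add_zero]
      refine (Padic.nonarchimedean _ _).trans (max_le ?_ ?_)
      · rw [norm_mul]; exact mul_le_one₀ hz1 (norm_nonneg _) hw2
      · rw [norm_mul]; exact mul_le_one₀ hz2 (norm_nonneg _) hw1
  · rintro z w ⟨hz1, hz2⟩ ⟨hw1, hw2⟩
    exact ⟨by rw [QuadraticAlgebra.re_add]; exact (Padic.nonarchimedean _ _).trans (max_le hz1 hw1),
      by rw [QuadraticAlgebra.im_add]; exact (Padic.nonarchimedean _ _).trans (max_le hz2 hw2)⟩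
  · rintro z ⟨hz1, hz2⟩
    exact ⟨by rw [QuadraticAlgebra.re_neg, norm_neg]; exact hz1, by rw [QuadraticAlgebra.im_neg, norm_neg]; exact hz2⟩

/-- **Cube roots of unity of `ℚ₃[ω]` are integral** (`ζ = a + bω`, `ζ³ = 1`: either `b = 0`, `‖a‖ = 1`, or `a = −1/2`, `r₃b² = −3/4`, and
`‖b‖² = ‖3‖/‖r₃‖ ≤ 1` when `‖3‖ ≤ ‖r₃‖`). [folklore] -/
theorem norm_le_one_of_pow_three_eq_one {r : ℚ_[3]} (h3r : ‖(3 : ℚ_[3])‖ ≤ ‖r‖)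
    {ζ : QuadraticAlgebra ℚ_[3] r 0} (hζ : ζ ^ 3 = 1) : ‖ζ.re‖ ≤ 1 ∧ ‖ζ.im‖ ≤ 1 := by
  have hre : (ζ ^ 3).re = 1 := by rw [hζ]; rfl
  have him : (ζ ^ 3).im = 0 := by rw [hζ]; rfl
  have e3 : ζ ^ 3 = ζ * ζ * ζ := by rw [pow_succ, pow_two]
  rw [e3] at hre him
  simp only [QuadraticAlgebra.re_mul, QuadraticAlgebra.im_mul, zero_mul, add_zero] at hre him
  -- `him : b·(3a² + r b²) = 0`, `hre : a³ + 3 r a b² = 1` with `a = ζ.re`, `b = ζ.im`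
  have him' : ζ.im * (3 * ζ.re ^ 2 + r * ζ.im ^ 2) = 0 := by linear_combination him
  have hre' : ζ.re ^ 3 + 3 * r * ζ.re * ζ.im ^ 2 = 1 := by linear_combination hre
  have h8 : ‖(8 : ℚ_[3])‖ = 1 := by
    have hle : ‖((8 : ℤ) : ℚ_[3])‖ ≤ 1 := Padic.norm_int_le_one (p := 3) 8
    have hlt : ¬ ‖((8 : ℤ) : ℚ_[3])‖ < 1 := by
      rw [Padic.norm_intCast_lt_one_iff]; norm_num
    have : ((8 : ℤ) : ℚ_[3]) = 8 := by norm_num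
    rw [this] at hle hlt
    exact le_antisymm hle (not_lt.mp hlt)
  rcases mul_eq_zero.mp him' with hb0 | hq
  · rw [hb0] at hre'
    have ha3 : ζ.re ^ 3 = 1 := by linear_combination hre'
    have hna : ‖ζ.re‖ ^ 3 = 1 := by rw [← norm_pow, ha3, norm_one]
    have hna1 : ‖ζ.re‖ = 1 := (pow_eq_one_iff_of_nonneg (norm_nonneg _) (by norm_num : (3 : ℕ) ≠ 0)).mp hna
    exact ⟨hna1.le, by rw [hb0, norm_zero]; exact zero_le_one⟩
  · -- `r b² = −3a²`, so `a³ − 9a³ = 1`, `a³ = −1/8`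
    have hrb : r * ζ.im ^ 2 = -3 * ζ.re ^ 2 := by linear_combination hq
    have ha3 : ζ.re ^ 3 = -1 / 8 := by
      have : ζ.re ^ 3 + 3 * ζ.re * (r * ζ.im ^ 2) = 1 := by linear_combination hre'
      rw [hrb] at this
      linear_combination this / (-8)
    have hna : ‖ζ.re‖ = 1 := by
      have h8' : ‖(-1 / 8 : ℚ_[3])‖ = 1 := by rw [norm_div, norm_neg, norm_one, h8, div_one]
      have hna3 : ‖ζ.re‖ ^ 3 = 1 := by rw [← norm_pow, ha3, h8']
      exact (pow_eq_one_iff_of_nonneg (norm_nonneg _) (by norm_num : (3 : ℕ) ≠ 0)).mp hna3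
    refine ⟨hna.le, ?_⟩
    -- `‖r‖‖b‖² = ‖3‖‖a‖² = ‖3‖ ≤ ‖r‖`
    have hnb : ‖r‖ * ‖ζ.im‖ ^ 2 = ‖(3 : ℚ_[3])‖ := by
      rw [← norm_pow, ← norm_mul, hrb, norm_mul, norm_neg, norm_pow, hna, one_pow, mul_one]
    have hr0 : 0 < ‖r‖ := lt_of_lt_of_le (by rw [norm_pos_iff]; norm_num) h3r
    have hb2 : ‖ζ.im‖ ^ 2 ≤ 1 := by
      have : ‖r‖ * ‖ζ.im‖ ^ 2 ≤ ‖r‖ * 1 := by rw [hnb, mul_one]; exact h3r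
      exact le_of_mul_le_mul_left this hr0
    nlinarith [norm_nonneg ζ.im]

/-! ### §2 The `3`-adic core -/

/-- **Components of the cube root are `3`-adically bounded** (see the file header for the setting and the mechanism). [folklore] -/
theorem components_threeAdicallyBounded (V : WeierstrassCurve ℤ_[3]) [hE : (V.map PadicInt.Coe.ringHom).IsElliptic]
    (hEa₁ : (V.map PadicInt.Coe.ringHom).a₁ = 0) (hEa₂ : (V.map PadicInt.Coe.ringHom).a₂ = 0) (hEa₃ : (V.map PadicInt.Coe.ringHom).a₃ = 0)
    {t : ℚ_[3]⟦X⟧} (ht0 : constantCoeff t = 0) (htne : t ≠ 0) (htint : IsPadicInt t)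
    (hDne : ((V.map PadicInt.Coe.ringHom).formalMul 3).subst t ≠ 0)
    {r₃ r₀ : ℚ_[3]} {t₀ : ℕ} (hr : r₃ = 3 ^ t₀ * r₀) (hr₀ : ‖r₀‖ = 1) (ht₀ : t₀ ≤ 1) (hns : ∀ x : ℚ_[3], x ^ 2 ≠ r₃)
    {X₁ y ℓ : ℚ_[3]} (hy : y ≠ 0)
    (heq : y ^ 2 * r₃ = X₁ ^ 3 + (V.map PadicInt.Coe.ringHom).a₄ * X₁ + (V.map PadicInt.Coe.ringHom).a₆)
    (hψ : (V.map PadicInt.Coe.ringHom).Ψ₃.eval X₁ = 0)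
    (hℓ : ℓ * (2 * y * r₃) = 3 * X₁ ^ 2 + (V.map PadicInt.Coe.ringHom).a₄)
    {P Q U Vv : ℚ_[3]⟦X⟧}
    (hP : P = -(V.map PadicInt.Coe.ringHom).formalXMulSq.subst (((V.map PadicInt.Coe.ringHom).formalMul 3).subst t))
    (hQ : Q = -C y * ((V.map PadicInt.Coe.ringHom).formalMul 3).subst t ^ 3
        - C ℓ * ((V.map PadicInt.Coe.ringHom).formalXMulSq.subst (((V.map PadicInt.Coe.ringHom).formalMul 3).subst t)
            * ((V.map PadicInt.Coe.ringHom).formalMul 3).subst t - C X₁ * ((V.map PadicInt.Coe.ringHom).formalMul 3).subst t ^ 3))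
    (hU : U ^ 3 + 3 * C r₃ * U * Vv ^ 2 = P) (hV : 3 * U ^ 2 * Vv + C r₃ * Vv ^ 3 = Q)
    {K₀ : ℕ} (hPint : IsPadicInt (C ((3 : ℚ_[3]) ^ K₀) * P)) (hQint : IsPadicInt (C ((3 : ℚ_[3]) ^ K₀) * Q)) :
    ∃ K : ℕ, IsPadicInt (C ((3 : ℚ_[3]) ^ K) * U) ∧ IsPadicInt (C ((3 : ℚ_[3]) ^ K) * Vv) := by
  -- the field `k = ℚ₃[ω]/(ω² = r₃)` and the subring `S`
  haveI hfact : Fact (∀ x : ℚ_[3], x ^ 2 ≠ r₃ + 0 * x) := ⟨fun x => by rw [zero_mul, add_zero]; exact hns x⟩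
  -- the generic-field statement of `kummerTripling_of_subring` (group law on `Affine.Point`) carries the CLASSICAL `DecidableEq`;
  -- a local classical instance takes precedence over the derived `instDecidableEqQuadraticAlgebra`
  letI : DecidableEq (QuadraticAlgebra ℚ_[3] r₃ 0) := Classical.decEq _
  have h3n : ‖(3 : ℚ_[3])‖ < 1 := by simpa using Padic.norm_p_lt_one (p := 3)
  have hr1 : ‖r₃‖ ≤ 1 := by
    rw [hr, norm_mul, norm_pow, hr₀, mul_one]; exact pow_le_one₀ (norm_nonneg _) h3n.le
  have h3r : ‖(3 : ℚ_[3])‖ ≤ ‖r₃‖ := by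
    rw [hr, norm_mul, norm_pow, hr₀, mul_one]
    interval_cases t₀
    · rw [pow_zero]; exact h3n.le
    · rw [pow_one]
  have hr₃0 : r₃ ≠ 0 := fun h0 => hns 0 (by rw [h0]; ring)
  obtain ⟨S, hSmem⟩ := exists_intSubring r₃ hr1
  set ψ : ℚ_[3] →+* (QuadraticAlgebra ℚ_[3] r₃ 0) := algebraMap ℚ_[3] (QuadraticAlgebra ℚ_[3] r₃ 0) with hψ'
  set φ : ℤ_[3] →+* (QuadraticAlgebra ℚ_[3] r₃ 0) := ψ.comp PadicInt.Coe.ringHom with hφ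
  have hψinj : Function.Injective ψ := (algebraMap ℚ_[3] (QuadraticAlgebra ℚ_[3] r₃ 0)).injective
  have hψapply : ∀ x : ℚ_[3], ψ x = ⟨x, 0⟩ := fun x => rfl
  have hψS : ∀ x : ℚ_[3], ‖x‖ ≤ 1 → ψ x ∈ S := fun x hx => by
    rw [hSmem, hψapply]; exact ⟨hx, by rw [norm_zero]; exact zero_le_one⟩
  have hφS : ∀ x : ℤ_[3], φ x ∈ S := fun x => hψS (x : ℚ_[3]) (PadicInt.norm_le_one x)
  -- the curve over `k`
  have hVφ : V.map φ = (V.map PadicInt.Coe.ringHom).map ψ := by rw [hφ, WeierstrassCurve.map_map]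
  haveI hEk : (V.map φ).IsElliptic := by rw [hVφ]; infer_instance
  have h2 : (2 : QuadraticAlgebra ℚ_[3] r₃ 0) ≠ 0 := by
    rw [show (2 : QuadraticAlgebra ℚ_[3] r₃ 0) = ψ 2 from (map_ofNat ψ 2).symm]; exact (map_ne_zero ψ).mpr two_ne_zero
  -- the point `T = (X₁, y·ω)`
  set X₁k : QuadraticAlgebra ℚ_[3] r₃ 0 := ψ X₁ with hX₁k
  set Y₁k : QuadraticAlgebra ℚ_[3] r₃ 0 := ⟨0, y⟩ with hY₁k
  have hYω : Y₁k = ψ y * ω := by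
    rw [hY₁k, hψapply]; apply QuadraticAlgebra.ext <;> simp
  have hωsq : (ω : QuadraticAlgebra ℚ_[3] r₃ 0) * ω = ψ r₃ := by
    rw [QuadraticAlgebra.omega_mul_omega_eq_mk, hψapply]
  have hY2 : Y₁k ^ 2 = ψ (y ^ 2 * r₃) := by
    rw [sq, hYω, map_mul, map_pow, ← hωsq]; ring
  have hka₁ : (V.map φ).a₁ = 0 := by rw [hVφ, map_a₁, hEa₁, map_zero]
  have hka₂ : (V.map φ).a₂ = 0 := by rw [hVφ, map_a₂, hEa₂, map_zero]
  have hka₃ : (V.map φ).a₃ = 0 := by rw [hVφ, map_a₃, hEa₃, map_zero]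
  have hka₄ : (V.map φ).a₄ = ψ (V.map PadicInt.Coe.ringHom).a₄ := by rw [hVφ, map_a₄]
  have hka₆ : (V.map φ).a₆ = ψ (V.map PadicInt.Coe.ringHom).a₆ := by rw [hVφ, map_a₆]
  have heqk : (V.map φ).toAffine.Equation X₁k Y₁k := by
    rw [Affine.equation_iff, hka₁, hka₂, hka₃, hka₄, hka₆, hY2, hX₁k, heq]
    simp only [map_add, map_mul, map_pow, zero_mul, add_zero]
  have hT : (V.map φ).toAffine.Nonsingular X₁k Y₁k := (Affine.equation_iff_nonsingular).mp heqk
  have h3T : 3 • Affine.Point.some X₁k Y₁k hT = 0 := by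
    rw [← natCast_zsmul]
    refine (Affine.Point.zsmul_some_eq_zero_iff hT 3).mpr ?_
    rw [WeierstrassCurve.ψ_three, Polynomial.evalEval_C, hVφ, WeierstrassCurve.map_Ψ₃, hX₁k, Polynomial.eval_map,
      Polynomial.eval₂_at_apply, hψ, map_zero]
  -- the slope `λ = ℓ·ω`
  have hY0 : Y₁k ≠ 0 := by
    intro h0; apply hy
    have := congrArg QuadraticAlgebra.im h0
    simpa [hY₁k] using this
  have hneg : Y₁k ≠ (V.map φ).toAffine.negY X₁k Y₁k := by
    rw [Affine.negY, hka₁, hka₃]; intro h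
    apply hY0; linear_combination (1 / 2 : QuadraticAlgebra ℚ_[3] r₃ 0) * h
  have hslope : (V.map φ).toAffine.slope X₁k X₁k Y₁k Y₁k = ψ ℓ * ω := by
    have hden : Y₁k - (V.map φ).toAffine.negY X₁k Y₁k = 2 * Y₁k := by rw [Affine.negY, hka₁, hka₃]; ring
    rw [Affine.slope_of_Y_ne rfl hneg, hden, hka₁, hka₂, hka₄, div_eq_iff (mul_ne_zero two_ne_zero hY0), hYω]
    have e : ψ ℓ * ω * (2 * (ψ y * ω)) = ψ (ℓ * (2 * y * r₃)) := by
      rw [map_mul, map_mul, map_mul, ← hωsq, map_ofNat]; ring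
    rw [e, hℓ, hX₁k]; simp only [map_add, map_mul, map_pow, map_ofNat, zero_mul, sub_zero, mul_zero, add_zero]
  -- the scaling constant `μ = 3^M`
  obtain ⟨M, hMX, hMY, hML⟩ := exists_norm_pow_mul_le_one₃ (p := 3) X₁ y ℓ
  set μ : QuadraticAlgebra ℚ_[3] r₃ 0 := ψ ((3 : ℚ_[3]) ^ M) with hμ
  have h3M0 : ((3 : ℚ_[3]) ^ M) ≠ 0 := pow_ne_zero M (by norm_num)
  have hμ0 : μ ≠ 0 := (map_ne_zero ψ).mpr h3M0
  have hμS : μ ∈ S := hψS _ (by rw [norm_pow]; exact pow_le_one₀ (norm_nonneg _) h3n.le)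
  have hmX : μ * X₁k ∈ S := by rw [hμ, hX₁k, ← map_mul]; exact hψS _ (by exact_mod_cast hMX)
  have hmY : μ * Y₁k ∈ S := by
    have e : μ * Y₁k = ⟨0, (3 : ℚ_[3]) ^ M * y⟩ := by
      rw [hμ, hY₁k, hψapply]; apply QuadraticAlgebra.ext <;> simp
    rw [e, hSmem]
    exact ⟨by rw [norm_zero]; exact zero_le_one, hMY⟩
  have hmL : μ * (V.map φ).toAffine.slope X₁k X₁k Y₁k Y₁k ∈ S := by
    have e : μ * (V.map φ).toAffine.slope X₁k X₁k Y₁k Y₁k = ⟨0, (3 : ℚ_[3]) ^ M * ℓ⟩ := by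
      rw [hslope, ← mul_assoc, hμ, ← map_mul, hψapply]; apply QuadraticAlgebra.ext <;> simp
    rw [e, hSmem]
    exact ⟨by rw [norm_zero]; exact zero_le_one, hML⟩
  -- the parameter over `k`
  obtain ⟨mapk, hmapk⟩ : ∃ mapk : ℚ_[3]⟦X⟧ →+* (QuadraticAlgebra ℚ_[3] r₃ 0)⟦X⟧, mapk = PowerSeries.map ψ := ⟨_, rfl⟩
  have hmapk_inj : Function.Injective mapk := by rw [hmapk]; exact PowerSeries.map_injective ψ hψinj
  set s : (QuadraticAlgebra ℚ_[3] r₃ 0)⟦X⟧ := mapk t with hs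
  have hs0 : constantCoeff s = 0 := by
    rw [hs, hmapk, ← coeff_zero_eq_constantCoeff, coeff_map, coeff_zero_eq_constantCoeff, ht0, map_zero]
  have hsne : s ≠ 0 := fun h0 => htne (hmapk_inj (by rw [← hs, h0, map_zero]))
  have hsint : s ∈ (PowerSeries.map S.subtype).range := by
    rw [mem_rangeS_iff_coeff]; intro n
    rw [hs, hmapk, coeff_map]; exact hψS _ ((isPadicInt_iff_coeff.mp htint) n)
  have hms : ∀ (f a : ℚ_[3]⟦X⟧), constantCoeff a = 0 → mapk (f.subst a) = (mapk f).subst (mapk a) := fun f a ha => by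
    rw [hmapk]
    change MvPowerSeries.map ψ (f.subst a) = _
    rw [PowerSeries.map_subst (HasSubst.of_constantCoeff_zero' ha)]
    rfl
  set D₃ := ((V.map PadicInt.Coe.ringHom).formalMul 3).subst t with hD₃
  have hD₃0 : constantCoeff D₃ = 0 := by
    rw [hD₃, Literature.RingTheory.FormalGroups.constantCoeff_subst_of_constantCoeff_eq_zero ht0, (V.map PadicInt.Coe.ringHom).constantCoeff_formalMul]
  have hDk : ((V.map φ).formalMul 3).subst s = mapk D₃ := by
    rw [hVφ, ← map_formalMul, ← hmapk, hs, hD₃, hms _ _ ht0]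
  have hDkne : ((V.map φ).formalMul 3).subst s ≠ 0 := by
    rw [hDk]; exact fun h0 => hDne (hmapk_inj (by rw [h0, map_zero]))
  have hXk : (V.map φ).formalXMulSq.subst (((V.map φ).formalMul 3).subst s) = mapk ((V.map PadicInt.Coe.ringHom).formalXMulSq.subst D₃) := by
    rw [hDk, hVφ, ← map_formalXMulSq, ← hmapk, hms _ _ hD₃0]
  -- TRIPLING over `(k, S)`
  obtain ⟨A, B, hAS, hBS, hB0, htrip⟩ :=
    kummerTripling_of_subring V φ S hφS h2 hT h3T hs0 hsne hsint hDkne hμ0 hμS hmX hmY hmL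
  rw [hXk, hDk, hslope] at htrip
  -- the tripling series is `comb P Q`
  have hΘ : -mapk ((V.map PadicInt.Coe.ringHom).formalXMulSq.subst D₃) - C Y₁k * mapk D₃ ^ 3 -
      C (ψ ℓ * ω) * (mapk ((V.map PadicInt.Coe.ringHom).formalXMulSq.subst D₃) * mapk D₃ - C X₁k * mapk D₃ ^ 3) = (PowerSeries.map (algebraMap ℚ_[3] (QuadraticAlgebra ℚ_[3] r₃ 0)) P + C (ω : QuadraticAlgebra ℚ_[3] r₃ 0) * PowerSeries.map (algebraMap ℚ_[3] (QuadraticAlgebra ℚ_[3] r₃ 0)) Q) := by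
    rw [hP, hQ, hYω, hX₁k]
    have e1 : (C (ψ y * ω) : (QuadraticAlgebra ℚ_[3] r₃ 0)⟦X⟧) = C (ω : QuadraticAlgebra ℚ_[3] r₃ 0) * mapk (C y) := by
      rw [hmapk, PowerSeries.map_C, ← map_mul, mul_comm]
    have e2 : (C (ψ ℓ * ω) : (QuadraticAlgebra ℚ_[3] r₃ 0)⟦X⟧) = C (ω : QuadraticAlgebra ℚ_[3] r₃ 0) * mapk (C ℓ) := by
      rw [hmapk, PowerSeries.map_C, ← map_mul, mul_comm]
    have e3 : (C (ψ X₁) : (QuadraticAlgebra ℚ_[3] r₃ 0)⟦X⟧) = mapk (C X₁) := by rw [hmapk, PowerSeries.map_C]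
    rw [e1, e2, e3]
    simp only [map_neg, map_sub, map_mul, map_pow, hmapk]
    ring
  rw [hΘ] at htrip
  -- the cube root `h = comb U V` and `x = hB = ζA`
  obtain ⟨h, hh⟩ : ∃ h : (QuadraticAlgebra ℚ_[3] r₃ 0)⟦X⟧, h = (PowerSeries.map (algebraMap ℚ_[3] (QuadraticAlgebra ℚ_[3] r₃ 0)) U + C (ω : QuadraticAlgebra ℚ_[3] r₃ 0) * PowerSeries.map (algebraMap ℚ_[3] (QuadraticAlgebra ℚ_[3] r₃ 0)) Vv) := ⟨_, rfl⟩
  have hh3 : h ^ 3 = (PowerSeries.map (algebraMap ℚ_[3] (QuadraticAlgebra ℚ_[3] r₃ 0)) P + C (ω : QuadraticAlgebra ℚ_[3] r₃ 0) * PowerSeries.map (algebraMap ℚ_[3] (QuadraticAlgebra ℚ_[3] r₃ 0)) Q) := by rw [hh, comb_pow_three, hU, hV]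
  have hx3 : (h * B) ^ 3 = A ^ 3 := by rw [mul_pow, hh3, htrip]
  obtain ⟨ζ, hζ3, hx⟩ := eq_C_mul_of_pow_three_eq' hx3
  have hζS : ζ ∈ S := (hSmem ζ).mpr (norm_le_one_of_pow_three_eq_one h3r hζ3)
  -- `N = B·B̄`, `C′ = ζ·A·B̄`
  obtain ⟨Bu, hBu⟩ : ∃ Bu : ℚ_[3]⟦X⟧, Bu = PowerSeries.mk fun n ↦ (coeff n B).re := ⟨_, rfl⟩
  obtain ⟨Bv, hBv⟩ : ∃ Bv : ℚ_[3]⟦X⟧, Bv = PowerSeries.mk fun n ↦ (coeff n B).im := ⟨_, rfl⟩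
  have hBc : B = (PowerSeries.map (algebraMap ℚ_[3] (QuadraticAlgebra ℚ_[3] r₃ 0)) Bu + C (ω : QuadraticAlgebra ℚ_[3] r₃ 0) * PowerSeries.map (algebraMap ℚ_[3] (QuadraticAlgebra ℚ_[3] r₃ 0)) Bv) := by
    rw [hBu, hBv]; exact (comb_reS_imS B).symm
  obtain ⟨Bbar, hBbar⟩ : ∃ Bbar : (QuadraticAlgebra ℚ_[3] r₃ 0)⟦X⟧, Bbar = (PowerSeries.map (algebraMap ℚ_[3] (QuadraticAlgebra ℚ_[3] r₃ 0)) Bu + C (ω : QuadraticAlgebra ℚ_[3] r₃ 0) * PowerSeries.map (algebraMap ℚ_[3] (QuadraticAlgebra ℚ_[3] r₃ 0)) (-Bv)) := ⟨_, rfl⟩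
  have hBint : IsPadicInt Bu ∧ IsPadicInt Bv := by
    have hc := (mem_rangeS_iff_coeff S).mp hBS
    refine ⟨isPadicInt_iff_coeff.mpr fun n => ?_, isPadicInt_iff_coeff.mpr fun n => ?_⟩
    · rw [hBu, coeff_mk]; exact ((hSmem _).mp (hc n)).1
    · rw [hBv, coeff_mk]; exact ((hSmem _).mp (hc n)).2
  have hBbarS : Bbar ∈ (PowerSeries.map S.subtype).range := by
    rw [mem_rangeS_iff_coeff]; intro n
    rw [hBbar, coeff_comb, hSmem]
    have hc := (hSmem _).mp (((mem_rangeS_iff_coeff S).mp hBS) n)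
    refine ⟨?_, ?_⟩
    · simpa [hBu, coeff_mk] using hc.1
    · simpa [hBv, coeff_mk, norm_neg] using hc.2
  obtain ⟨n₃, hn₃⟩ : ∃ n₃ : ℚ_[3]⟦X⟧, n₃ = Bu ^ 2 - C r₃ * Bv ^ 2 := ⟨_, rfl⟩
  have hN : B * Bbar = mapk n₃ := by
    have e : (PowerSeries.map (algebraMap ℚ_[3] (QuadraticAlgebra ℚ_[3] r₃ 0)) Bu + C (ω : QuadraticAlgebra ℚ_[3] r₃ 0) * PowerSeries.map (algebraMap ℚ_[3] (QuadraticAlgebra ℚ_[3] r₃ 0)) Bv) * Bbar = mapk n₃ := by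
      rw [hBbar, comb_mul_comb_neg, comb_zero_right, hn₃, hmapk, hψ']
    rwa [← hBc] at e
  have hn₃int : IsPadicInt n₃ := by
    rw [hn₃]
    exact (hBint.1.pow 2).sub ((IsPadicInt.powerSeries_C hr1).mul (hBint.2.pow 2))
  have hBbar0 : Bbar ≠ 0 := by
    intro h0
    have h0' : (PowerSeries.map (algebraMap ℚ_[3] (QuadraticAlgebra ℚ_[3] r₃ 0)) Bu + C (ω : QuadraticAlgebra ℚ_[3] r₃ 0) * PowerSeries.map (algebraMap ℚ_[3] (QuadraticAlgebra ℚ_[3] r₃ 0)) (-Bv)) = (PowerSeries.map (algebraMap ℚ_[3] (QuadraticAlgebra ℚ_[3] r₃ 0)) 0 + C (ω : QuadraticAlgebra ℚ_[3] r₃ 0) * PowerSeries.map (algebraMap ℚ_[3] (QuadraticAlgebra ℚ_[3] r₃ 0)) 0) := by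
      rw [← hBbar, h0]; simp
    have := comb_injective h0'
    apply hB0
    rw [hBc, this.1, neg_eq_zero.mp this.2, map_zero, mul_zero, add_zero]
  have hn₃0 : n₃ ≠ 0 := by
    intro h0
    have : B * Bbar = 0 := by rw [hN, h0, map_zero]
    rcases mul_eq_zero.mp this with h1 | h1
    · exact hB0 h1
    · exact hBbar0 h1
  obtain ⟨C', hC'⟩ : ∃ C' : (QuadraticAlgebra ℚ_[3] r₃ 0)⟦X⟧, C' = C ζ * A * Bbar := ⟨_, rfl⟩
  have hC'S : C' ∈ (PowerSeries.map S.subtype).range := by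
    rw [hC']
    exact Subring.mul_mem _ (Subring.mul_mem _ (C_mem_rangeS S hζS) hAS) hBbarS
  obtain ⟨c₁, hc₁⟩ : ∃ c₁ : ℚ_[3]⟦X⟧, c₁ = PowerSeries.mk fun n ↦ (coeff n C').re := ⟨_, rfl⟩
  obtain ⟨c₂, hc₂⟩ : ∃ c₂ : ℚ_[3]⟦X⟧, c₂ = PowerSeries.mk fun n ↦ (coeff n C').im := ⟨_, rfl⟩
  have hC'c : C' = (PowerSeries.map (algebraMap ℚ_[3] (QuadraticAlgebra ℚ_[3] r₃ 0)) c₁ + C (ω : QuadraticAlgebra ℚ_[3] r₃ 0) * PowerSeries.map (algebraMap ℚ_[3] (QuadraticAlgebra ℚ_[3] r₃ 0)) c₂) := by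
    rw [hc₁, hc₂]; exact (comb_reS_imS C').symm
  have hcint : IsPadicInt c₁ ∧ IsPadicInt c₂ := by
    have hc := (mem_rangeS_iff_coeff S).mp hC'S
    refine ⟨isPadicInt_iff_coeff.mpr fun n => ?_, isPadicInt_iff_coeff.mpr fun n => ?_⟩
    · rw [hc₁, coeff_mk]; exact ((hSmem _).mp (hc n)).1
    · rw [hc₂, coeff_mk]; exact ((hSmem _).mp (hc n)).2
  -- `N·h = C′` in components
  have hkey : mapk n₃ * h = (PowerSeries.map (algebraMap ℚ_[3] (QuadraticAlgebra ℚ_[3] r₃ 0)) c₁ + C (ω : QuadraticAlgebra ℚ_[3] r₃ 0) * PowerSeries.map (algebraMap ℚ_[3] (QuadraticAlgebra ℚ_[3] r₃ 0)) c₂) := by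
    rw [← hC'c, hC', ← hN, ← hx]; ring
  have hcomp : n₃ * U = c₁ ∧ n₃ * Vv = c₂ := by
    have e : mapk n₃ * h = (PowerSeries.map (algebraMap ℚ_[3] (QuadraticAlgebra ℚ_[3] r₃ 0)) (n₃ * U) + C (ω : QuadraticAlgebra ℚ_[3] r₃ 0) * PowerSeries.map (algebraMap ℚ_[3] (QuadraticAlgebra ℚ_[3] r₃ 0)) (n₃ * Vv)) := by
      rw [hh, hmapk, hψ', ← comb_zero_right (K := ℚ_[3]) (r := r₃) n₃, comb_mul_comb]
      congr 1 <;> ring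
    rw [e] at hkey
    exact comb_injective hkey
  -- the cube system in `ℚ₃⟦X⟧`
  have hsys : c₁ ^ 3 + 3 * C r₃ * c₁ * c₂ ^ 2 = n₃ ^ 3 * P ∧ 3 * c₁ ^ 2 * c₂ + C r₃ * c₂ ^ 3 = n₃ ^ 3 * Q := by
    have e : (PowerSeries.map (algebraMap ℚ_[3] (QuadraticAlgebra ℚ_[3] r₃ 0)) c₁ + C (ω : QuadraticAlgebra ℚ_[3] r₃ 0) * PowerSeries.map (algebraMap ℚ_[3] (QuadraticAlgebra ℚ_[3] r₃ 0)) c₂) ^ 3 = (PowerSeries.map (algebraMap ℚ_[3] (QuadraticAlgebra ℚ_[3] r₃ 0)) (n₃ ^ 3 * P) + C (ω : QuadraticAlgebra ℚ_[3] r₃ 0) * PowerSeries.map (algebraMap ℚ_[3] (QuadraticAlgebra ℚ_[3] r₃ 0)) (n₃ ^ 3 * Q)) := by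
      rw [← hkey, mul_pow, hh3, ← map_pow, hmapk, hψ', ← comb_zero_right (K := ℚ_[3]) (r := r₃) (n₃ ^ 3), comb_mul_comb]
      congr 1 <;> ring
    rw [comb_pow_three] at e
    exact comb_injective e
  -- lift to `ℤ₃⟦X⟧` and descend
  obtain ⟨κ, hκ⟩ : ∃ κ : ℤ_[3]⟦X⟧ →+* ℚ_[3]⟦X⟧, κ = PowerSeries.map (PadicInt.Coe.ringHom (p := 3)) := ⟨_, rfl⟩
  have hκinj : Function.Injective κ := by rw [hκ]; exact PowerSeries.map_injective _ Subtype.val_injective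
  obtain ⟨c₁', hc₁''⟩ := isPadicInt_iff_exists_powerSeries_map.mp hcint.1
  obtain ⟨c₂', hc₂''⟩ := isPadicInt_iff_exists_powerSeries_map.mp hcint.2
  obtain ⟨n', hn''⟩ := isPadicInt_iff_exists_powerSeries_map.mp hn₃int
  obtain ⟨P', hP'⟩ := isPadicInt_iff_exists_powerSeries_map.mp hPint
  obtain ⟨Q', hQ'⟩ := isPadicInt_iff_exists_powerSeries_map.mp hQint
  have hc₁' : κ c₁' = c₁ := by rw [hκ]; exact hc₁''
  have hc₂' : κ c₂' = c₂ := by rw [hκ]; exact hc₂''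
  have hn' : κ n' = n₃ := by rw [hκ]; exact hn''
  have hPκ : κ P' = C ((3 : ℚ_[3]) ^ K₀) * P := by rw [hκ]; exact hP'
  have hQκ : κ Q' = C ((3 : ℚ_[3]) ^ K₀) * Q := by rw [hκ]; exact hQ'
  obtain ⟨r₀', hr₀'⟩ : ∃ r₀' : ℤ_[3], (r₀' : ℚ_[3]) = r₀ := ⟨⟨r₀, hr₀.le⟩, rfl⟩
  have hr₀'u : IsUnit (C r₀' : ℤ_[3]⟦X⟧) := by
    have hu : IsUnit r₀' := PadicInt.isUnit_iff.mpr (by rw [PadicInt.norm_def, hr₀']; exact hr₀)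
    exact (PowerSeries.isUnit_iff_constantCoeff (φ := C r₀')).mpr (by rwa [constantCoeff_C])
  have h4 : IsUnit (4 : ℤ_[3]⟦X⟧) := CubeSystemDescent.isUnit_four
  have hκC : κ (C r₀') = C r₀ := by
    rw [hκ, PowerSeries.map_C, ← hr₀']; rfl
  have hP'' : κ P' = 3 ^ K₀ * P := by rw [hPκ, map_pow, map_ofNat]
  have hQ'' : κ Q' = 3 ^ K₀ * Q := by rw [hQκ, map_pow, map_ofNat]
  have hCr : (C r₃ : ℚ_[3]⟦X⟧) = 3 ^ t₀ * C r₀ := by rw [hr, map_mul, map_pow, map_ofNat]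
  have E1 : 3 ^ K₀ * (c₁' ^ 3 + 3 * (3 ^ t₀ * C r₀') * c₁' * c₂' ^ 2) = n' ^ 3 * P' := by
    apply hκinj
    simp only [map_mul, map_add, map_pow, map_ofNat, hc₁', hc₂', hn', hP'', hκC]
    have e := hsys.1
    rw [hCr] at e
    linear_combination (3 : ℚ_[3]⟦X⟧) ^ K₀ * e
  have E2 : 3 ^ K₀ * (3 * c₁' ^ 2 * c₂' + (3 ^ t₀ * C r₀') * c₂' ^ 3) = n' ^ 3 * Q' := by
    apply hκinj
    simp only [map_mul, map_add, map_pow, map_ofNat, hc₁', hc₂', hn', hQ'', hκC]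
    have e := hsys.2
    rw [hCr] at e
    linear_combination (3 : ℚ_[3]⟦X⟧) ^ K₀ * e
  have hn'0 : n' ≠ 0 := fun h0 => hn₃0 (by rw [← hn', h0, map_zero])
  obtain ⟨⟨g₁, hg₁⟩, ⟨g₂, hg₂⟩⟩ := CubeSystemDescent.dvd_of_cube_system h4 hr₀'u hn'0 E1 E2
  -- conclude
  refine ⟨K₀ + t₀, ?_, ?_⟩
  · have e : n₃ * (C ((3 : ℚ_[3]) ^ (K₀ + t₀)) * U) = n₃ * κ g₁ := by
      have e1 : κ (3 ^ (K₀ + t₀) * c₁') = κ (n' * g₁) := by rw [hg₁]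
      rw [map_mul, map_mul, map_pow, map_ofNat, hc₁', hn', ← hcomp.1] at e1
      rw [map_pow, map_ofNat]
      linear_combination e1
    rw [mul_left_cancel₀ hn₃0 e]
    rw [hκ]; exact isPadicInt_iff_exists_powerSeries_map.mpr ⟨g₁, rfl⟩
  · have e : n₃ * (C ((3 : ℚ_[3]) ^ (K₀ + t₀)) * Vv) = n₃ * κ g₂ := by
      have e1 : κ (3 ^ (K₀ + t₀) * c₂') = κ (n' * g₂) := by rw [hg₂]
      rw [map_mul, map_mul, map_pow, map_ofNat, hc₂', hn', ← hcomp.2] at e1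
      rw [map_pow, map_ofNat]
      linear_combination e1
    rw [mul_left_cancel₀ hn₃0 e]
    rw [hκ]; exact isPadicInt_iff_exists_powerSeries_map.mpr ⟨g₂, rfl⟩

end Summit.BirchSwinnertonDyer.BirchSwinnertonDyer.Theorems.ManinLocalTwoThree.KLineBI

end
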